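import Summits.CriticalPhenomena.SAWScalingLimit.Theorems.SAWTotalPositivityCriticalBubbleBoundJoinUnfoldTail
import Literature.Probability.RandomPlanarGeometry.SAWReflect

/-!
# Hammond's unfolding of polygons with many global join plaquettes, III: the injection into bridges
(line `docking-census-joining`, stub `gjoins_unfold` = Hammond's Proposition 4.5, multi-valued map part)

Crux `stmt-CriticalPhenomena-7117`
(`Summit.CriticalPhenomena.SAWScalingLimit.Theses.SAWTotalPositivity.CriticalBubbleBound`), line
`docking-census-joining`, JOIN-MASS programme (lead c6); third of three files (`…JoinUnfoldPrep`,
`…JoinUnfoldTail`, this file). Registered stub `gjoins_unfold`: for `N ≥ 3` and `m` there is a map `Φ`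
sending `(χ, κ)` — `χ ∈ lexRooted N`, `κ ⊆ gjoins N χ` pairwise non-touching with `|κ| = m` — to an
`(N + 2m + 6)`-step bridge (`Zd.bridges`), injectively. THE MAP: `W(χ, κ)` = head arc `χ 0, …, χ (esIdx)
= ES` followed by the mirror image in the line `x = xmax + 1/2` of the detoured tail (`Unfold.wlist`,
Hammond's `S_κ(φ)`; a self-avoiding walk from `0` of `N + 2m + 1` steps in the upper half-plane ending
at `(2·xmax, 0)`: head and mirrored tail lie in the complementary half-planes `{x ≤ xmax}`,
`{x ≥ xmax + 1}`); then pad by four vertical steps (`Unfold.pad`), fold the segment after the last visit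
of the top row `y = M` upward through `y = M + 1/2` (`Unfold.fold` = `Zd.reflectTail`, one extra step)
and transpose (`Unfold.swapXY`): the start is the unique lowest vertex and the end a highest one, a
bridge of `N + 2m + 6` steps. RECOVERY (`gjoins_unfold_walk`, `Unfold.walk_eq_of_bridge_eq`): `M` from
the final ordinate, the folding time as the last time at height `≤ M`, un-fold, un-pad; `xmax` from the
endpoint, the junction as the last vertex with abscissa `≤ xmax`, un-mirror, parse the detours
(`Unfold.dtail_parse`, `Unfold.kappa_subset`).

Sources: A. Hammond, Ann. Probab. 46 (2018) = arXiv:1808.09032, Proposition 4.5 and its proof;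
N. Madras, G. Slade, *The Self-Avoiding Walk* (1993), §3.1 (unfolding), Definition 1.2.4 (bridges).
-/

noncomputable section

open Literature.Probability.LatticeModels
open Literature.Probability.RandomPlanarGeometry Literature.Probability.RandomPlanarGeometry.SAW
open scoped BigOperators
open Summit.CriticalPhenomena.SAWScalingLimit.Theorems.CriticalBubbleBound.Negative (e₀)
open Summit.CriticalPhenomena.SAWScalingLimit.Theorems.CriticalBubbleBound.Docking

namespace Summit.CriticalPhenomena.SAWScalingLimit.Theorems.CriticalBubbleBound.Join

variable {N : ℕ} {χ : ℕ → Site 2} {κ : Finset (Site 2)}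

namespace Unfold

/-! ## Recovering `κ` -/

/-- RECOVERING `κ`: for one polygon, the detours along the tail determine the non-touching set of
plaquettes. [cite: Hammond2015SAPJoining, Proposition 4.5] -/
theorem kappa_subset {κ' : Finset (Site 2)} (hχ : χ ∈ lexRooted N) (hN : 3 ≤ N)
    (hκ : κ ⊆ gjoins N χ) (hnt : ∀ q ∈ κ, ∀ q' ∈ κ, q ≠ q' → 2 ≤ |q 0 - q' 0| ∨ 2 ≤ |q 1 - q' 1|)
    (hdet : ∀ i, esIdx N χ ≤ i → i < N → det χ κ i = det χ κ' i) : κ ⊆ κ' := by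
  intro q hq
  obtain ⟨-, i, hji, hiN, hs⟩ := gjoins_arcs N χ hχ hN q (hκ hq)
  have h := hdet i hji hiN
  have hne : χ i + e₁ ≠ χ i - e₁ := fun h => by
    have := congrFun h 1
    simp only [Pi.add_apply, Pi.sub_apply, e₀_e₁_apply.2.2.2] at this
    omega
  unfold det at h
  rcases hs with hs | hs
  · rw [if_pos ⟨q, hq, hs⟩] at h
    split_ifs at h with h₁ h₂
    · obtain ⟨q', hq', hs'⟩ := h₁
      rwa [hseg_inj (hs.symm.trans hs')]
    · simp [hne] at h
  · have hno : ¬ ∃ q₀ ∈ κ, s(χ i, χ (i + 1)) = s(q₀, q₀ + e₀) := by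
      rintro ⟨q₀, hq₀, hs₀⟩
      obtain rfl := sides_unique hnt hq₀ hq (Or.inl hs₀) (Or.inr hs)
      exact hi_ne_lo _ (hs.symm.trans hs₀)
    rw [if_neg hno, if_pos ⟨q, hq, hs⟩] at h
    split_ifs at h with h₁ h₂
    · simp [hne.symm] at h
    · obtain ⟨q', hq', hs'⟩ := h₂
      have := hs.symm.trans hs'
      rw [add_right_comm q e₀ e₁, add_right_comm q' e₀ e₁] at this
      obtain rfl : q = q' := add_right_cancel (hseg_inj this)
      exact hq'

/-! ## The unfolded walk `W = head ++ mirror image of the detoured tail` -/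

/-- Hammond's `S_κ(φ)` as a vertex list: the head `χ 0, …, χ (esIdx) = ES`, then the mirror
image of the detoured tail in the vertical line `x = xmax + 1/2`.
[cite: Hammond2015SAPJoining, Proposition 4.5] -/
def wlist (N : ℕ) (χ : ℕ → Site 2) (κ : Finset (Site 2)) : List (Site 2) :=
  (List.range (esIdx N χ + 1)).map χ ++
    (dtail N χ κ (N - esIdx N χ)).map (Zd.reflAt 0 (2 * xmax N χ + 1))

/-- The head vertices lie in `{x ≤ xmax}` above row `0`. [folklore] -/
theorem mem_wlist_head (hχ : χ ∈ lexRooted N) {x : Site 2}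
    (hx : x ∈ (List.range (esIdx N χ + 1)).map χ) : x 0 ≤ xmax N χ ∧ 0 ≤ x 1 := by
  obtain ⟨l, hl, rfl⟩ := List.mem_map.1 hx
  have hjN := (esIdx_spec N χ).1
  have hlN : l ≤ N := by have := List.mem_range.1 hl; omega
  exact ⟨apply_le_xmax χ hlN, apply_one_nonneg_of_mem_lexRooted hχ hlN⟩

/-- The mirrored detoured tail lies in `{x ≥ xmax + 1}` above row `0`. [folklore] -/
theorem mem_wlist_tail (hχ : χ ∈ lexRooted N) (hN : 3 ≤ N) (hκ : κ ⊆ gjoins N χ) {x : Site 2}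
    (hx : x ∈ (dtail N χ κ (N - esIdx N χ)).map (Zd.reflAt 0 (2 * xmax N χ + 1))) :
    xmax N χ + 1 ≤ x 0 ∧ 0 ≤ x 1 := by
  obtain ⟨y, hy, rfl⟩ := List.mem_map.1 hx
  have hjN := (esIdx_spec N χ).1
  obtain ⟨h0, h1⟩ := coord_dtail hχ hN hκ (by omega) hy (by omega)
  rw [Zd.reflAt_apply_same, Zd.reflAt_apply_of_ne (show (1 : Fin 2) ≠ 0 by decide)]
  exact ⟨by omega, h1⟩

/-- Length of the unfolded walk: `N + 2|κ| + 2` vertices. [folklore] -/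
theorem length_wlist (hχ : χ ∈ lexRooted N) (hN : 3 ≤ N) (hκ : κ ⊆ gjoins N χ)
    (hnt : ∀ q ∈ κ, ∀ q' ∈ κ, q ≠ q' → 2 ≤ |q 0 - q' 0| ∨ 2 ≤ |q 1 - q' 1|) :
    (wlist N χ κ).length = N + 2 * κ.card + 2 := by
  have hj := (esIdx_spec N χ).1
  rw [wlist, List.length_append, List.length_map, List.length_range, List.length_map,
    length_dtail N χ κ _ (by omega), show N - (N - esIdx N χ) = esIdx N χ by omega,
    sum_length_det hχ hN hκ hnt]
  omega

/-- The unfolded walk starts at the root `0`. [folklore] -/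
theorem head?_wlist (hχ : χ ∈ lexRooted N) (κ : Finset (Site 2)) : (wlist N χ κ).head? = some 0 := by
  rw [wlist, List.head?_append, List.head?_map, List.head?_range, ← (Zd.mem_sawFun.1 (lexRooted_subset N hχ)).1]
  rfl

/-- The unfolded walk ends at the mirror image of `e₀`. [folklore] -/
theorem getLast?_wlist (N : ℕ) (χ : ℕ → Site 2) (κ : Finset (Site 2)) (hχ : χ ∈ lexRooted N) :
    (wlist N χ κ).getLast? = some (Zd.reflAt 0 (2 * xmax N χ + 1) e₀) := by
  rw [wlist, List.getLast?_append, List.getLast?_map, getLast?_dtail,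
    (Zd.mem_sawFun.1 (lexRooted_subset N hχ)).2.1 N le_rfl]
  rfl

/-- The unfolded walk is a lattice path: head steps, the junction `ES → ES + e₀`, mirrored steps.
[cite: Hammond2015SAPJoining, Proposition 4.5] -/
theorem isChain_wlist (hχ : χ ∈ lexRooted N) (κ : Finset (Site 2)) :
    List.IsChain (fun a b => (zdGraph 2).Adj a b) (wlist N χ κ) := by
  have hsaw := lexRooted_subset N hχ
  obtain ⟨-, -, hadj, -⟩ := Zd.mem_sawFun.1 hsaw
  obtain ⟨hjN, hjES⟩ := esIdx_spec N χ
  refine List.IsChain.append ?_ ?_ fun x hx y hy => ?_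
  · refine List.isChain_iff_getElem.2 fun i hi => ?_
    simp only [List.length_map, List.length_range] at hi
    simp only [List.getElem_map, List.getElem_range]
    exact hadj i (by omega)
  · exact List.isChain_map_of_isChain _ (fun a b h => (Zd.zdGraph_adj_reflAt 0 _ a b).2 h)
      (isChain_dtail hsaw κ _ (by omega))
  · rw [List.getLast?_eq_getElem?, List.length_map, List.length_range, Nat.add_sub_cancel,
      List.getElem?_map, List.getElem?_range (by omega), Option.map_some, Option.mem_def,
      Option.some.injEq] at hx
    rw [List.head?_map, head?_dtail, Option.map_some, Option.mem_def, Option.some.injEq,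
      show N - (N - esIdx N χ) = esIdx N χ by omega] at hy
    rw [← hx, ← hy]
    have hES0 : χ (esIdx N χ) 0 = xmax N χ := by rw [hjES]; rfl
    rw [← hES0, Zd.reflAt_two_mul_add_one]
    exact (zdGraph_adj_iff _ _).2 ⟨0, Or.inl rfl⟩

/-- The unfolded walk is self-avoiding: the head is, the mirrored detoured tail is, and they lie
in the complementary half-planes `{x ≤ xmax}`, `{x ≥ xmax + 1}`.
[cite: Hammond2015SAPJoining, Proposition 4.5] -/
theorem nodup_wlist (hχ : χ ∈ lexRooted N) (hN : 3 ≤ N) (hκ : κ ⊆ gjoins N χ)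
    (hnt : ∀ q ∈ κ, ∀ q' ∈ κ, q ≠ q' → 2 ≤ |q 0 - q' 0| ∨ 2 ≤ |q 1 - q' 1|) :
    (wlist N χ κ).Nodup := by
  have hsaw := lexRooted_subset N hχ
  have hinj := (Zd.mem_sawFun.1 hsaw).2.2.2
  have hjN := (esIdx_spec N χ).1
  refine List.nodup_append.2 ⟨?_, ?_, fun a ha b hb hab => ?_⟩
  · refine List.nodup_range.map_on fun a ha b hb h => ?_
    rw [List.mem_range] at ha hb
    exact hinj (show a ≤ N by omega) (show b ≤ N by omega) h
  · exact (nodup_dtail hχ hN hκ hnt _ le_rfl).map (Zd.reflAt_injective 0 _)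
  · have h1 := (mem_wlist_head hχ ha).1
    have h2 := (mem_wlist_tail hχ hN hκ hb).1
    rw [hab] at h1
    omega

/-- SPLITTING two equal unfolded walks with the same `xmax` at the junction: the heads and the
mirrored tails agree (the first vertex after the head is the first one beyond `xmax`). [folklore] -/
theorem wlist_split {χ' : ℕ → Site 2} {κ' : Finset (Site 2)} (hχ : χ ∈ lexRooted N)
    (hχ' : χ' ∈ lexRooted N) (hN : 3 ≤ N) (hκ : κ ⊆ gjoins N χ) (hκ' : κ' ⊆ gjoins N χ')
    (h : wlist N χ κ = wlist N χ' κ') (hx : xmax N χ = xmax N χ') :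
    (List.range (esIdx N χ + 1)).map χ = (List.range (esIdx N χ' + 1)).map χ' ∧
      (dtail N χ κ (N - esIdx N χ)).map (Zd.reflAt 0 (2 * xmax N χ + 1)) =
        (dtail N χ' κ' (N - esIdx N χ')).map (Zd.reflAt 0 (2 * xmax N χ' + 1)) := by
  rw [wlist, wlist, List.append_eq_append_iff] at h
  rcases h with ⟨a', h1, h2⟩ | ⟨c', h1, h2⟩
  · rcases eq_or_ne a' [] with rfl | hne
    · rw [List.append_nil] at h1; rw [List.nil_append] at h2; exact ⟨h1.symm, h2⟩
    · exfalso
      obtain ⟨x, hx'⟩ := List.exists_mem_of_ne_nil a' hne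
      have hH := (mem_wlist_head hχ' (h1 ▸ List.mem_append_right _ hx')).1
      have hT := (mem_wlist_tail hχ hN hκ (h2 ▸ List.mem_append_left _ hx')).1
      omega
  · rcases eq_or_ne c' [] with rfl | hne
    · rw [List.append_nil] at h1; rw [List.nil_append] at h2; exact ⟨h1, h2.symm⟩
    · exfalso
      obtain ⟨x, hx'⟩ := List.exists_mem_of_ne_nil c' hne
      have hH := (mem_wlist_head hχ (h1 ▸ List.mem_append_right _ hx')).1
      have hT := (mem_wlist_tail hχ' hN hκ' (h2 ▸ List.mem_append_left _ hx')).1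
      omega

end Unfold

open Unfold in
/-- **`gjoins_unfold_walk`.** The unfolded walks `W(χ, κ)` (head, then the mirror
image in `x = xmax + 1/2` of the tail detoured around the `m` plaquettes of `κ`) are
`(N + 2m + 1)`-step self-avoiding walks from `0` in the upper half-plane ending on row `0`, and
`(χ, κ) ↦ W(χ, κ)` is injective: `xmax` is read off the endpoint, the junction is the last vertex
with abscissa `≤ xmax`, the head and the detoured tail are recovered by un-mirroring, and the tail
and `κ` by parsing the detours. [cite: Hammond2015SAPJoining, Proposition 4.5] -/
theorem gjoins_unfold_walk : ∀ (N m : ℕ), 3 ≤ N → ∃ W : (ℕ → Site 2) → Finset (Site 2) → (ℕ → Site 2), (∀ χ ∈ lexRooted N, ∀ κ ⊆ gjoins N χ, (∀ q ∈ κ, ∀ q' ∈ κ, q ≠ q' → 2 ≤ |q 0 - q' 0| ∨ 2 ≤ |q 1 - q' 1|) → κ.card = m → W χ κ ∈ Zd.saws 2 (N + 2 * m + 1) ∧ (∀ i, 0 ≤ W χ κ i 1) ∧ W χ κ (N + 2 * m + 1) 1 = 0) ∧ (∀ χ ∈ lexRooted N, ∀ χ' ∈ lexRooted N, ∀ κ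 ⊆ gjoins N χ, ∀ κ' ⊆ gjoins N χ', (∀ q ∈ κ, ∀ q' ∈ κ, q ≠ q' → 2 ≤ |q 0 - q' 0| ∨ 2 ≤ |q 1 - q' 1|) → (∀ q ∈ κ', ∀ q' ∈ κ', q ≠ q' → 2 ≤ |q 0 - q' 0| ∨ 2 ≤ |q 1 - q' 1|) → κ.card = m → κ'.card = m → W χ κ = W χ' κ' → χ = χ' ∧ κ = κ') := by
  intro N m hN
  refine ⟨fun χ κ => toFun (wlist N χ κ), ?_, ?_⟩
  · intro χ hχ κ hκ hnt hm
    have hlen := length_wlist hχ hN hκ hnt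
    rw [hm] at hlen
    have hpos : 0 < (wlist N χ κ).length := by omega
    refine ⟨?_, fun i => ?_, ?_⟩
    · have := toFun_mem_saws hpos (isChain_wlist hχ κ) (nodup_wlist hχ hN hκ hnt) (head?_wlist hχ κ)
      rwa [hlen, show N + 2 * m + 2 - 1 = N + 2 * m + 1 by omega] at this
    · have hmem := toFun_mem hpos i
      rw [wlist, List.mem_append] at hmem
      rcases hmem with hmem | hmem
      · exact (mem_wlist_head hχ hmem).2
      · exact (mem_wlist_tail hχ hN hκ hmem).2
    · show toFun (wlist N χ κ) (N + 2 * m + 1) 1 = 0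
      have hlast := getLast?_wlist N χ κ hχ
      rw [List.getLast?_eq_getElem?, hlen, show N + 2 * m + 2 - 1 = N + 2 * m + 1 by omega,
        List.getElem?_eq_getElem (by omega), Option.some.injEq] at hlast
      rw [toFun_apply (by omega), hlast, Zd.reflAt_apply_of_ne (show (1 : Fin 2) ≠ 0 by decide)]
      rfl
  · intro χ hχ χ' hχ' κ hκ κ' hκ' hnt hnt' hm hm' h
    have hsaw := lexRooted_subset N hχ
    have hsaw' := lexRooted_subset N hχ'
    have hjN := (esIdx_spec N χ).1
    have hL : wlist N χ κ = wlist N χ' κ' :=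
      toFun_inj h (by rw [length_wlist hχ hN hκ hnt, length_wlist hχ' hN hκ' hnt', hm, hm'])
    have hx : xmax N χ = xmax N χ' := by
      have h1 := getLast?_wlist N χ κ hχ
      rw [hL, getLast?_wlist N χ' κ' hχ', Option.some.injEq] at h1
      have h2 := congrFun h1 0
      rw [Zd.reflAt_apply_same, Zd.reflAt_apply_same] at h2
      omega
    obtain ⟨hH, hT⟩ := wlist_split hχ hχ' hN hκ hκ' hL hx
    have hj : esIdx N χ = esIdx N χ' := by
      have := congrArg List.length hH
      simp only [List.length_map, List.length_range] at this
      omega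
    rw [← hj] at hH
    have hhead : ∀ l ≤ esIdx N χ, χ l = χ' l := fun l hl =>
      List.map_inj_left.1 hH l (List.mem_range.2 (by omega))
    rw [← hx, ← hj] at hT
    have hdt := (List.map_injective_iff.2 (Zd.reflAt_injective 0 _)) hT
    obtain ⟨htail, hdet⟩ := dtail_parse hχ hχ' hN hκ hκ' hj hhead _ le_rfl hdt
    obtain rfl : χ = χ' := by
      funext i
      rcases le_or_gt i (esIdx N χ) with hi | hi
      · exact hhead i hi
      rcases le_or_gt i N with hiN | hiN
      · exact htail i (by omega) hiN
      · rw [(Zd.mem_sawFun.1 hsaw).2.1 i hiN.le, (Zd.mem_sawFun.1 hsaw').2.1 i hiN.le]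
    refine ⟨rfl, Finset.eq_of_subset_of_card_le (kappa_subset hχ hN hκ hnt fun i hi hi' => ?_)
      (by omega)⟩
    exact hdet i (by omega) hi'

namespace Unfold

/-! ## From upper half-plane walks to bridges: fold the tail upward, transpose -/

/-- The LAST visit, up to time `n`, of the top row `y = ymax`. [folklore] -/
def tstar (n : ℕ) (ω : ℕ → Site 2) : ℕ := Nat.findGreatest (fun i => ω i 1 = ymax n ω) n

/-- Specification of `tstar`. [folklore] -/
theorem tstar_spec (n : ℕ) (ω : ℕ → Site 2) :
    tstar n ω ≤ n ∧ ω (tstar n ω) 1 = ymax n ω ∧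
      ∀ i, tstar n ω < i → i ≤ n → ω i 1 < ymax n ω := by
  obtain ⟨i₀, hi₀, h₀⟩ := exists_apply_eq_ymax n ω
  refine ⟨Nat.findGreatest_le n,
    Nat.findGreatest_spec (P := fun i => ω i 1 = ymax n ω) hi₀ h₀, fun i h1 h2 => ?_⟩
  exact lt_of_le_of_ne (apply_le_ymax ω h2)
    (Nat.findGreatest_is_greatest (P := fun i => ω i 1 = ymax n ω) h1 h2)

/-- FOLDING: reflect the segment after the last visit of the top row `y = M` in the line
`y = M + 1/2` (half-step unfolding; the endpoint becomes a highest vertex).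
[cite: MadrasSlade1993, §3.1] -/
def fold (n : ℕ) (ω : ℕ → Site 2) : ℕ → Site 2 :=
  Zd.reflectTail 1 (2 * ymax n ω + 1) (tstar n ω) ω

/-- Folding an `n`-step self-avoiding walk gives an `(n+1)`-step one. [cite: MadrasSlade1993, §3.1] -/
theorem fold_mem_saws {n : ℕ} {ω : ℕ → Site 2} (hω : ω ∈ Zd.saws 2 n) :
    fold n ω ∈ Zd.saws 2 (n + 1) := by
  obtain ⟨hT, hTmax, -⟩ := tstar_spec n ω
  have := Zd.reflectTail_mem_saws_of_isMax (k := 1) hω hT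
    (fun i hi => by rw [hTmax]; exact apply_le_ymax ω hi)
  rwa [hTmax] at this

/-- **Upper half-plane walks ending on the axis give bridges.** For an `n`-step self-avoiding
walk `W` from `0` with all ordinates `≥ 0` and final ordinate `0`: pad, fold the final segment
after the last visit of the top row upward, transpose; the result is an `(n+5)`-step bridge
(start strictly lowest, end highest). [cite: MadrasSlade1993, §3.1] -/
theorem bridge_of_walk {n : ℕ} {W : ℕ → Site 2} (hW : W ∈ Zd.saws 2 n) (hnn : ∀ i, 0 ≤ W i 1)
    (hend : W n 1 = 0) : swapXY (fold (n + 4) (pad W)) ∈ Zd.bridges 2 (n + 4 + 1) := by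
  have hωs : pad W ∈ Zd.saws 2 (n + 4) := pad_mem_saws hW hnn
  obtain ⟨hT, hTmax, -⟩ := tstar_spec (n + 4) (pad W)
  have hge4 : ∀ i, 4 ≤ i → 4 ≤ pad W i 1 := fun i hi => by
    rw [pad_apply_one_of_le W hi]
    linarith [hnn (i - 4)]
  have hleM : ∀ i, i ≤ n + 4 → pad W i 1 ≤ ymax (n + 4) (pad W) := fun i hi =>
    apply_le_ymax (pad W) hi
  have hM4 : 4 ≤ ymax (n + 4) (pad W) := le_trans (hge4 4 le_rfl) (hleM 4 (by omega))
  have hT4 : 4 ≤ tstar (n + 4) (pad W) := by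
    by_contra h
    rw [pad_apply_one_of_lt W (by omega)] at hTmax
    omega
  refine Zd.mem_bridges.2 ⟨swapXY_mem_saws (fold_mem_saws hωs), fun i hi1 hi2 => ?_⟩
  show fold (n + 4) (pad W) 0 1 < fold (n + 4) (pad W) i 1 ∧
    fold (n + 4) (pad W) i 1 ≤ fold (n + 4) (pad W) (n + 4 + 1) 1
  rw [fold, Zd.reflectTail_apply_of_le _ _ _ _ (Nat.zero_le _),
    Zd.reflectTail_apply_of_lt_level _ _ _ _ (by omega : tstar (n + 4) (pad W) < n + 4 + 1),
    Nat.add_sub_cancel, pad_apply_one_of_le W (show 4 ≤ n + 4 by omega), Nat.add_sub_cancel, hend,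
    pad_apply_one_of_lt W (show 0 < 4 by norm_num)]
  push_cast
  rcases le_or_gt i (tstar (n + 4) (pad W)) with hiT | hiT
  · rw [Zd.reflectTail_apply_of_le _ _ _ _ hiT]
    rcases Nat.lt_or_ge i 4 with hi4 | hi4
    · rw [pad_apply_one_of_lt W hi4]
      constructor <;> omega
    · have := hge4 i hi4
      have := hleM i (by omega)
      constructor <;> omega
  · rw [Zd.reflectTail_apply_of_lt_level _ _ _ _ hiT]
    have := hge4 (i - 1) (by omega)
    have := hleM (i - 1) (by omega)
    constructor <;> omega

/-- **Injectivity of the bridge construction** on upper half-plane walks ending on the axis: the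
top row `M` is read off the final ordinate `2M - 3`, the folding time is the last time with
ordinate `≤ M`, folding with known parameters is injective, and so are padding and transposing.
[cite: MadrasSlade1993, §3.1] -/
theorem walk_eq_of_bridge_eq {n : ℕ} {W W' : ℕ → Site 2} (hend : W n 1 = 0) (hend' : W' n 1 = 0)
    (h : swapXY (fold (n + 4) (pad W)) = swapXY (fold (n + 4) (pad W'))) : W = W' := by
  have h1 : fold (n + 4) (pad W) = fold (n + 4) (pad W') := swapXY_injective h
  have hM : ymax (n + 4) (pad W) = ymax (n + 4) (pad W') := by
    have hT := (tstar_spec (n + 4) (pad W)).1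
    have hT' := (tstar_spec (n + 4) (pad W')).1
    have := congrFun (congrFun h1 (n + 4 + 1)) 1
    rw [fold, fold, Zd.reflectTail_apply_of_lt_level _ _ _ _ (by omega),
      Zd.reflectTail_apply_of_lt_level _ _ _ _ (by omega), Nat.add_sub_cancel,
      pad_apply_one_of_le W (by omega), pad_apply_one_of_le W' (by omega), Nat.add_sub_cancel,
      hend, hend'] at this
    omega
  have key : ∀ {V V' : ℕ → Site 2}, fold (n + 4) V = fold (n + 4) V' →
      ymax (n + 4) V = ymax (n + 4) V' → ¬ tstar (n + 4) V < tstar (n + 4) V' := by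
    intro V V' hf hm hlt
    obtain ⟨hT', hTmax', -⟩ := tstar_spec (n + 4) V'
    have h2 := congrFun (congrFun hf (tstar (n + 4) V')) 1
    rw [fold, fold, Zd.reflectTail_apply_of_lt_level _ _ _ _ hlt,
      Zd.reflectTail_apply_of_le _ _ _ _ le_rfl, hTmax'] at h2
    have := apply_le_ymax (n := n + 4) V (i := tstar (n + 4) V' - 1) (by omega)
    omega
  have hTT : tstar (n + 4) (pad W) = tstar (n + 4) (pad W') := by
    rcases lt_trichotomy (tstar (n + 4) (pad W)) (tstar (n + 4) (pad W')) with hlt | heq | hgt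
    · exact absurd hlt (key h1 hM)
    · exact heq
    · exact absurd hgt (key h1.symm hM.symm)
  rw [fold, fold, hM, hTT] at h1
  exact pad_injective (Zd.reflectTail_injective _ _ _ h1)

end Unfold

/-! ## Hammond's Proposition 4.5: the multi-valued map into bridges -/

open Unfold in
/-- **Stub `gjoins_unfold` (Hammond's Proposition 4.5, the multi-valued map, anchor at the root).**
For `N ≥ 3` and `m` there is a map `Φ` sending a lex-rooted polygon `χ ∈ lexRooted N` together
with a set `κ` of `m` pairwise non-touching GLOBAL join plaquettes of `P(χ)` to an
`(N + 2m + 6)`-step bridge, injectively in `(χ, κ)`: keep the head arc `χ[0, esIdx]` (root → `ES`),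
replace in the tail arc `χ[esIdx, N]` the step across each plaquette of `κ` by the three-step
detour around it (the detour vertices are head vertices, by Lemma 4.7, and distinct plaquettes of
`κ` have disjoint corners), reflect the detoured tail in the vertical line `x = xmax + 1/2` (head
and mirrored tail lie in complementary half-planes), then pad by four vertical steps, fold the
final segment after the last visit of the top row upward and transpose. Recovery: unfold, unpad,
read `xmax` off the endpoint, split at the last vertex with abscissa `≤ xmax`, un-mirror, and parse
the detours (a detour vertex is a head vertex, a tail vertex is not).
[cite: Hammond2015SAPJoining, Proposition 4.5] -/
theorem gjoins_unfold : ∀ (N m : ℕ), 3 ≤ N → ∃ Φ : (ℕ → Site 2) → Finset (Site 2) → (ℕ → Site 2), (∀ χ ∈ lexRooted N, ∀ κ ⊆ gjoins N χ, (∀ q ∈ κ, ∀ q' ∈ κ, q ≠ q' → 2 ≤ |q 0 - q' 0| ∨ 2 ≤ |q 1 - q' 1|) → κ.card = m → Φ χ κ ∈ Zd.bridges 2 (N + 2 * m + 6)) ∧ (∀ χ ∈ lexRooted N, ∀ χ' ∈ lexRooted N, ∀ κ ⊆ gjoins N χ, ∀ κ' ⊆ gjoins N χ', (∀ q ∈ κ,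 ∀ q' ∈ κ, q ≠ q' → 2 ≤ |q 0 - q' 0| ∨ 2 ≤ |q 1 - q' 1|) → (∀ q ∈ κ', ∀ q' ∈ κ', q ≠ q' → 2 ≤ |q 0 - q' 0| ∨ 2 ≤ |q 1 - q' 1|) → κ.card = m → κ'.card = m → Φ χ κ = Φ χ' κ' → χ = χ' ∧ κ = κ') := by
  intro N m hN
  obtain ⟨W, hW, hWinj⟩ := gjoins_unfold_walk N m hN
  refine ⟨fun χ κ => swapXY (fold (N + 2 * m + 1 + 4) (pad (W χ κ))), ?_, ?_⟩
  · intro χ hχ κ hκ hnt hm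
    obtain ⟨h1, h2, h3⟩ := hW χ hχ κ hκ hnt hm
    exact bridge_of_walk h1 h2 h3
  · intro χ hχ χ' hχ' κ hκ κ' hκ' hnt hnt' hm hm' h
    obtain ⟨-, -, h3⟩ := hW χ hχ κ hκ hnt hm
    obtain ⟨-, -, h3'⟩ := hW χ' hχ' κ' hκ' hnt' hm'
    exact hWinj χ hχ χ' hχ' κ hκ κ' hκ' hnt hnt' hm hm' (walk_eq_of_bridge_eq h3 h3' h)
end Summit.CriticalPhenomena.SAWScalingLimit.Theorems.CriticalBubbleBound.Join

end
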